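import Summits.Ventures.Crystal3D.Theorems.StickyWulffConstantGenericWallFloorDockedExact
import HarnessLib

/-!
# RIGID DOCKING, hcp type: a docked end ball sharing three independent slot neighbours with an hcp docking dozen sees
# one of the grain's eight TWIN DOZENS (crux `GenericWallFloor`, stmt-Ventures-19480, line `WallLedgerG`; item (G-c″))

HONEST FRAMING. Venture `Summits/Ventures/Crystal3D` (cell `crystal3d-full`), helper `--supports` the crux `GenericWallFloor` of
`route-Ventures-StickyWulffConstant`, REGISTERED line `WallLedgerG`, open stub `stub_twoSlabAdhesion`.  Rung credit only; F-C1
not moved; NOT the crux.  Pure proofs, census-free, standard axioms; no kissing facts.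

Sequel of `…DockedExact` (fcc type, `docked_fcc_exact`).  Here the docking ball `s` has an hcp (anticuboctahedral) dozen
`{s + B p : p ∈ hcpKissingPattern}` through the end ball `z`, and three linearly independent slot neighbours `z + A wᵢ ∈ X` of
`z`'s grain frame `A` touch `s`.  **`docked_hcp_twin`**: the dozen of `s` is a TWIN DOZEN of the grain,
`{A w : ⟪A w, n⟫ ≤ 0} ∪ {A w − 2⟪A w, n⟫ n : ⟪A w, n⟫ < 0}` for a unit `{111}` normal `n` of `A` — the second alternative of
the named statement `DockedMenu` (…DockedMenuDefs).  Mechanism, on the integer model of …KissingPatterns / …SlotDozensCubic: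
* `hcpInt_sub_cases` (kernel `decide`): the difference of two ADJACENT anticuboctahedron vectors is an fcc vector `q`, or the
  twin image `R q` of an fcc vector with `q₀+q₁+q₂ ≠ 0` (`R` = reflection in the hexagonal plane `x₀+x₁+x₂ = 0`);
* `inner_fcc_twinRefl_not_menu`: the MENU TRICK for all signs — an fcc vector and a twinned fcc vector, both off the hexagonal
  plane, meet at `±1/3` or `±5/6`, never at a slot angle; so the three shared slots `A wᵢ = B(pᵢ − p₀)` lie all in `B(fccKP)`
  or all in `(B∘R)(fccKP)`, and `fccDozen_eq_slots_of_three_independent` + `hcpDozen_eq_twin_of_fccDozen_eq` (…SlotDozens)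
  finish, with `B(hcpKP) = (B∘R)(hcpKP)` by the `R`-symmetry of the anticuboctahedron (`twinRefl_image_hcp`).
Exact case check (seat calc/hcp_docking_check.py): 48 vertex/triple cases = 36 twin-dozen + 12 «mixed» (vacuous: Gram entry −1/3).
WHAT THIS IS NOT: not the count supplying the three shared neighbours; no ledger; F-C1 not moved.
-/

noncomputable section

namespace Summit.Ventures.Crystal3D.Theorems

open Summit.Ventures.Crystal3D Finset
open Literature.Geometry.DiscreteGeometry (fccKissingPattern hcpKissingPattern fccInt hcpInt intVec intVec_apply intVec_sub
  sqNormInt norm_intVec)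
open Literature.MathematicalPhysics.StatisticalMechanics (fccStacking)
open scoped InnerProductSpace

variable {X : Finset (EuclideanSpace ℝ (Fin 3))}

/-! ### §1 Adjacent differences of the anticuboctahedron (integer model) -/

/-- **Adjacent differences of the anticuboctahedron** (integer model, scale `3`): for `v₀, v ∈ hcpInt` at squared distance
`18` (adjacent vertices), `v − v₀` is `3u` for an fcc vector `u`, or the twin image `3u − 2(u₀+u₁+u₂)(1,1,1)` of an fcc
vector `u` off the hexagonal plane. -/
theorem hcpInt_sub_cases : ∀ v₀ ∈ hcpInt, ∀ v ∈ hcpInt, sqNormInt (v - v₀) = 18 →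
    (∃ u ∈ fccInt, v - v₀ = (3 : ℤ) • u) ∨
    (∃ u ∈ fccInt, u 0 + u 1 + u 2 ≠ 0 ∧ v - v₀ = (3 : ℤ) • u - (2 * (u 0 + u 1 + u 2)) • ![(1 : ℤ), 1, 1]) := by
  decide

/-- The squared-norm bookkeeping: two hcp pattern points at distance `1` have integer models at squared distance `18`. -/
theorem sqNormInt_sub_eq_of_dist_eq_one {v₀ v : Fin 3 → ℤ}
    (h : dist ((Real.sqrt ((18 : ℕ) : ℝ))⁻¹ • intVec v₀ : EuclideanSpace ℝ (Fin 3))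
      ((Real.sqrt ((18 : ℕ) : ℝ))⁻¹ • intVec v) = 1) :
    sqNormInt (v - v₀) = 18 := by
  have h18 : (0 : ℝ) < Real.sqrt ((18 : ℕ) : ℝ) := by positivity
  rw [dist_comm, dist_eq_norm, ← smul_sub, intVec_sub, norm_smul, norm_inv, Real.norm_of_nonneg h18.le, norm_intVec,
    inv_mul_eq_iff_eq_mul₀ h18.ne', mul_one] at h
  have h0 : (0 : ℝ) ≤ (sqNormInt (v - v₀) : ℝ) := by
    have : (0 : ℤ) ≤ sqNormInt (v - v₀) := by unfold sqNormInt; positivity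
    exact_mod_cast this
  have := (Real.sqrt_inj h0 (by positivity)).1 h
  exact_mod_cast this

/-- **Adjacent differences, real form.**  For `p₀, p ∈ hcpKissingPattern` with `dist p₀ p = 1`: `p − p₀ = q` for an fcc
pattern vector `q`, or `p − p₀ = R q` for an fcc pattern vector `q` with `q₀ + q₁ + q₂ ≠ 0`
(`R` the reflection in the hexagonal plane). -/
theorem hcp_sub_cases {p₀ p : EuclideanSpace ℝ (Fin 3)} (hp₀ : p₀ ∈ hcpKissingPattern) (hp : p ∈ hcpKissingPattern)
    (hd : dist p₀ p = 1) :
    (∃ q ∈ fccKissingPattern, p - p₀ = q) ∨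
    (∃ q ∈ fccKissingPattern, q 0 + q 1 + q 2 ≠ 0 ∧
      p - p₀ = (ℝ ∙ (intVec ![1, 1, 1] : EuclideanSpace ℝ (Fin 3)))ᗮ.reflection q) := by
  obtain ⟨v₀, hv₀, rfl⟩ := Finset.mem_image.1 hp₀
  obtain ⟨v, hv, rfl⟩ := Finset.mem_image.1 hp
  have h18 := sqNormInt_sub_eq_of_dist_eq_one hd
  have hsub : ((Real.sqrt ((18 : ℕ) : ℝ))⁻¹ • intVec v : EuclideanSpace ℝ (Fin 3)) -
      (Real.sqrt ((18 : ℕ) : ℝ))⁻¹ • intVec v₀ = (Real.sqrt ((18 : ℕ) : ℝ))⁻¹ • intVec (v - v₀) := by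
    rw [← smul_sub, intVec_sub]
  have hc2 : (0 : ℝ) < (Real.sqrt ((2 : ℕ) : ℝ))⁻¹ := by positivity
  rcases hcpInt_sub_cases v₀ hv₀ v hv h18 with ⟨u, hu, he⟩ | ⟨u, hu, hs, he⟩
  · left
    refine ⟨(Real.sqrt ((2 : ℕ) : ℝ))⁻¹ • intVec u, Finset.mem_image.2 ⟨u, hu, rfl⟩, ?_⟩
    rw [hsub, he, fcc_scaled_eq]
  · right
    refine ⟨(Real.sqrt ((2 : ℕ) : ℝ))⁻¹ • intVec u, Finset.mem_image.2 ⟨u, hu, rfl⟩, ?_, ?_⟩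
    · rw [sum_coord_scaled]
      exact mul_ne_zero hc2.ne' (Int.cast_ne_zero.2 hs)
    · rw [hsub, he, twinRefl_fcc_scaled_eq]

/-! ### §2 The menu trick for all signs -/

/-- **Menu trick, all signs.**  An fcc pattern vector `p` and the twin image `R q` of an fcc pattern vector `q`, both off the
hexagonal plane (`p₀+p₁+p₂ ≠ 0`, `q₀+q₁+q₂ ≠ 0`), have inner product `±1/3` or `±5/6` — never a slot value `1, ½, 0, −½, −1`. -/
theorem inner_fcc_twinRefl_not_menu {p q : EuclideanSpace ℝ (Fin 3)} (hp : p ∈ fccKissingPattern)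
    (hq : q ∈ fccKissingPattern) (hsp : p 0 + p 1 + p 2 ≠ 0) (hsq : q 0 + q 1 + q 2 ≠ 0) :
    ¬ (⟪p, (ℝ ∙ (intVec ![1, 1, 1] : EuclideanSpace ℝ (Fin 3)))ᗮ.reflection q⟫_ℝ = 1 ∨
       ⟪p, (ℝ ∙ (intVec ![1, 1, 1] : EuclideanSpace ℝ (Fin 3)))ᗮ.reflection q⟫_ℝ = 1 / 2 ∨
       ⟪p, (ℝ ∙ (intVec ![1, 1, 1] : EuclideanSpace ℝ (Fin 3)))ᗮ.reflection q⟫_ℝ = 0 ∨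
       ⟪p, (ℝ ∙ (intVec ![1, 1, 1] : EuclideanSpace ℝ (Fin 3)))ᗮ.reflection q⟫_ℝ = -(1 / 2) ∨
       ⟪p, (ℝ ∙ (intVec ![1, 1, 1] : EuclideanSpace ℝ (Fin 3)))ᗮ.reflection q⟫_ℝ = -1) := by
  set R := (ℝ ∙ (intVec ![1, 1, 1] : EuclideanSpace ℝ (Fin 3)))ᗮ.reflection with hR
  -- reduce to positive coordinate sums by the central symmetry of the cuboctahedron
  have key : ∀ p' q' : EuclideanSpace ℝ (Fin 3), p' ∈ fccKissingPattern → q' ∈ fccKissingPattern →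
      0 < p' 0 + p' 1 + p' 2 → 0 < q' 0 + q' 1 + q' 2 →
      ⟪p', R q'⟫_ℝ = -1 / 3 ∨ ⟪p', R q'⟫_ℝ = -5 / 6 := fun p' q' hp' hq' hs hs' =>
    inner_fcc_twinRefl_of_pos hp' hq' hs hs'
  have hval : ⟪p, R q⟫_ℝ = -1 / 3 ∨ ⟪p, R q⟫_ℝ = -5 / 6 ∨ ⟪p, R q⟫_ℝ = 1 / 3 ∨ ⟪p, R q⟫_ℝ = 5 / 6 := by
    have hnp : (-p) 0 + (-p) 1 + (-p) 2 = -(p 0 + p 1 + p 2) := by simp only [PiLp.neg_apply]; ring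
    have hnq : (-q) 0 + (-q) 1 + (-q) 2 = -(q 0 + q 1 + q 2) := by simp only [PiLp.neg_apply]; ring
    rcases hsp.lt_or_gt with hp' | hp' <;> rcases hsq.lt_or_gt with hq' | hq'
    · have h := key (-p) (-q) (neg_mem_fccKissingPattern hp) (neg_mem_fccKissingPattern hq)
        (by rw [hnp]; linarith) (by rw [hnq]; linarith)
      rw [map_neg, inner_neg_left, inner_neg_right, neg_neg] at h
      rcases h with h | h
      · exact Or.inl h
      · exact Or.inr (Or.inl h)
    · have h := key (-p) q (neg_mem_fccKissingPattern hp) hq (by rw [hnp]; linarith) hq'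
      rw [inner_neg_left] at h
      rcases h with h | h
      · exact Or.inr (Or.inr (Or.inl (by linarith)))
      · exact Or.inr (Or.inr (Or.inr (by linarith)))
    · have h := key p (-q) hp (neg_mem_fccKissingPattern hq) hp' (by rw [hnq]; linarith)
      rw [map_neg, inner_neg_right] at h
      rcases h with h | h
      · exact Or.inr (Or.inr (Or.inl (by linarith)))
      · exact Or.inr (Or.inr (Or.inr (by linarith)))
    · have h := key p q hp hq hp' hq'
      rcases h with h | h
      · exact Or.inl h
      · exact Or.inr (Or.inl h)
  rintro (h | h | h | h | h) <;> rcases hval with h' | h' | h' | h' <;> linarith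

/-! ### §3 Rigid docking, hcp type -/

/-- **RIGID DOCKING (hcp type).**  `A` a grain frame; `z ∈ X`, `s` with `dist s z = 1` whose contacts in `X` all lie in the hcp
dozen `{s + B p : p ∈ hcpKissingPattern}`; three slot neighbours `z + A wᵢ ∈ X` (`wᵢ ∈ fccSlots` linearly independent) touch `s`.
Then the dozen of `s` is a TWIN DOZEN of the grain: for some unit `{111}` normal `n` of `A` it is
`{A w : ⟪A w, n⟫ ≤ 0} ∪ {A w − 2⟪A w, n⟫ n : ⟪A w, n⟫ < 0}`. -/
theorem docked_hcp_twin (A : EuclideanSpace ℝ (Fin 3) ≃ₗᵢ[ℝ] EuclideanSpace ℝ (Fin 3))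
    {z s : EuclideanSpace ℝ (Fin 3)} (hz : z ∈ X)
    (B : EuclideanSpace ℝ (Fin 3) →ₗᵢ[ℝ] EuclideanSpace ℝ (Fin 3))
    (hall : ∀ q ∈ X, dist s q = 1 → ∃ p ∈ hcpKissingPattern, q = s + B p) (hsz : dist s z = 1)
    {w₁ w₂ w₃ : EuclideanSpace ℝ (Fin 3)} (hw₁ : w₁ ∈ fccSlots) (hw₂ : w₂ ∈ fccSlots) (hw₃ : w₃ ∈ fccSlots)
    (hind : LinearIndependent ℝ ![w₁, w₂, w₃])
    (hX₁ : z + A w₁ ∈ X) (hX₂ : z + A w₂ ∈ X) (hX₃ : z + A w₃ ∈ X)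
    (hd₁ : dist s (z + A w₁) = 1) (hd₂ : dist s (z + A w₂) = 1) (hd₃ : dist s (z + A w₃) = 1) :
    ∃ n : EuclideanSpace ℝ (Fin 3), ‖n‖ = 1 ∧
      (∀ w ∈ fccSlots, ⟪A w, n⟫_ℝ = 0 ∨ ⟪A w, n⟫_ℝ = Real.sqrt (2 / 3) ∨ ⟪A w, n⟫_ℝ = -Real.sqrt (2 / 3)) ∧
      B '' (↑hcpKissingPattern : Set (EuclideanSpace ℝ (Fin 3))) =
        (fun w => A w) '' {w | w ∈ fccSlots ∧ ⟪A w, n⟫_ℝ ≤ 0} ∪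
          (fun w => A w - (2 * ⟪A w, n⟫_ℝ) • n) '' {w | w ∈ fccSlots ∧ ⟪A w, n⟫_ℝ < 0} := by
  set R : EuclideanSpace ℝ (Fin 3) ≃ₗᵢ[ℝ] EuclideanSpace ℝ (Fin 3) :=
    (ℝ ∙ (intVec ![1, 1, 1] : EuclideanSpace ℝ (Fin 3)))ᗮ.reflection with hR
  set B' : EuclideanSpace ℝ (Fin 3) →ₗᵢ[ℝ] EuclideanSpace ℝ (Fin 3) := B.comp R.toLinearIsometry with hB'def
  have hB' : ∀ p, B' p = B (R p) := fun p => rfl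
  obtain ⟨p₀, hp₀, hzp⟩ := hall z hz hsz
  -- each touching slot neighbour gives the shared slot `A w = B (p − p₀)` with `p` adjacent to `p₀`
  have shared : ∀ w ∈ fccSlots, z + A w ∈ X → dist s (z + A w) = 1 →
      (∃ q ∈ fccKissingPattern, q 0 + q 1 + q 2 ≠ 0 ∧ A w = B q) ∨
      (∃ q ∈ fccKissingPattern, q 0 + q 1 + q 2 = 0 ∧ A w = B q) ∨
      (∃ q ∈ fccKissingPattern, q 0 + q 1 + q 2 ≠ 0 ∧ A w = B' q) := by
    intro w hw hwX hwd
    obtain ⟨p, hp, hqp⟩ := hall _ hwX hwd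
    have hAw : A w = B (p - p₀) := by
      have h1 : A w = (z + A w) - z := by abel
      rw [h1, hqp, hzp, map_sub]; abel
    have hdist : dist p₀ p = 1 := by
      rw [dist_comm, dist_eq_norm, ← LinearIsometry.norm_map B (p - p₀), ← hAw, LinearIsometryEquiv.norm_map,
        norm_eq_one_of_mem_fccSlots hw]
    rcases hcp_sub_cases hp₀ hp hdist with ⟨q, hq, he⟩ | ⟨q, hq, hs, he⟩
    · by_cases hs : q 0 + q 1 + q 2 = 0
      · exact Or.inr (Or.inl ⟨q, hq, hs, by rw [hAw, he]⟩)
      · exact Or.inl ⟨q, hq, hs, by rw [hAw, he]⟩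
    · exact Or.inr (Or.inr ⟨q, hq, hs, by rw [hAw, he, hB']⟩)
  -- slots of one grain meet at slot angles only
  have menu : ∀ x y : EuclideanSpace ℝ (Fin 3), x ∈ A '' (↑fccSlots : Set (EuclideanSpace ℝ (Fin 3))) →
      y ∈ A '' (↑fccSlots : Set (EuclideanSpace ℝ (Fin 3))) →
      ⟪x, y⟫_ℝ = 1 ∨ ⟪x, y⟫_ℝ = 1 / 2 ∨ ⟪x, y⟫_ℝ = 0 ∨ ⟪x, y⟫_ℝ = -(1 / 2) ∨ ⟪x, y⟫_ℝ = -1 := by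
    intro x y hx hy
    rw [image_fccSlots_eq_units] at hx hy
    exact inner_mem_of_unit_slots A hx.1 hy.1 hx.2 hy.2
  have slotA : ∀ w ∈ fccSlots, A w ∈ A '' (↑fccSlots : Set (EuclideanSpace ℝ (Fin 3))) :=
    fun w hw => ⟨w, Finset.mem_coe.2 hw, rfl⟩
  -- an off-plane fcc representative and an off-plane twinned representative cannot coexist among slots of `A`
  have excl : ∀ x y : EuclideanSpace ℝ (Fin 3), x ∈ A '' (↑fccSlots : Set (EuclideanSpace ℝ (Fin 3))) →
      y ∈ A '' (↑fccSlots : Set (EuclideanSpace ℝ (Fin 3))) →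
      ∀ q ∈ fccKissingPattern, q 0 + q 1 + q 2 ≠ 0 → x = B q →
      ∀ q' ∈ fccKissingPattern, q' 0 + q' 1 + q' 2 ≠ 0 → y = B' q' → False := by
    intro x y hx hy q hq hsq hxq q' hq' hsq' hyq'
    have hin : ⟪x, y⟫_ℝ = ⟪q, R q'⟫_ℝ := by rw [hxq, hyq', hB', LinearIsometry.inner_map_map]
    have h := menu x y hx hy
    rw [hin] at h
    exact inner_fcc_twinRefl_not_menu hq hq' hsq hsq' h
  have hindA : LinearIndependent ℝ ![A w₁, A w₂, A w₃] := linearIndependent_map_triple A hind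
  obtain s₁ := shared w₁ hw₁ hX₁ hd₁
  obtain s₂ := shared w₂ hw₂ hX₂ hd₂
  obtain s₃ := shared w₃ hw₃ hX₃ hd₃
  by_cases hpos : ∃ x : EuclideanSpace ℝ (Fin 3), (x = A w₁ ∨ x = A w₂ ∨ x = A w₃) ∧
      ∃ q ∈ fccKissingPattern, q 0 + q 1 + q 2 ≠ 0 ∧ x = B q
  · -- all three shared slots lie in the fcc dozen `B(fccKissingPattern)`
    obtain ⟨x₀, hx₀, q₀, hq₀, hs₀, hx₀q⟩ := hpos
    have hx₀A : x₀ ∈ A '' (↑fccSlots : Set (EuclideanSpace ℝ (Fin 3))) := by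
      rcases hx₀ with rfl | rfl | rfl
      exacts [slotA w₁ hw₁, slotA w₂ hw₂, slotA w₃ hw₃]
    have toF : ∀ w ∈ fccSlots,
        ((∃ q ∈ fccKissingPattern, q 0 + q 1 + q 2 ≠ 0 ∧ A w = B q) ∨
          (∃ q ∈ fccKissingPattern, q 0 + q 1 + q 2 = 0 ∧ A w = B q) ∨
          (∃ q ∈ fccKissingPattern, q 0 + q 1 + q 2 ≠ 0 ∧ A w = B' q)) →
        A w ∈ B '' (↑fccKissingPattern : Set (EuclideanSpace ℝ (Fin 3))) := by
      rintro w hw (⟨q, hq, -, he⟩ | ⟨q, hq, -, he⟩ | ⟨q, hq, hs, he⟩)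
      · exact ⟨q, Finset.mem_coe.2 hq, he.symm⟩
      · exact ⟨q, Finset.mem_coe.2 hq, he.symm⟩
      · exact (excl x₀ (A w) hx₀A (slotA w hw) q₀ hq₀ hs₀ hx₀q q hq hs he).elim
    exact hcpDozen_eq_twin_of_fccDozen_eq A B
      (fccDozen_eq_slots_of_three_independent A B (toF w₁ hw₁ s₁) (toF w₂ hw₂ s₂) (toF w₃ hw₃ s₃)
        (slotA w₁ hw₁) (slotA w₂ hw₂) (slotA w₃ hw₃) hindA)
  · -- no off-plane fcc representative: all three shared slots lie in the fcc dozen of `B' = B ∘ R`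
    have toF' : ∀ w ∈ fccSlots, (A w = A w₁ ∨ A w = A w₂ ∨ A w = A w₃) →
        ((∃ q ∈ fccKissingPattern, q 0 + q 1 + q 2 ≠ 0 ∧ A w = B q) ∨
          (∃ q ∈ fccKissingPattern, q 0 + q 1 + q 2 = 0 ∧ A w = B q) ∨
          (∃ q ∈ fccKissingPattern, q 0 + q 1 + q 2 ≠ 0 ∧ A w = B' q)) →
        A w ∈ B' '' (↑fccKissingPattern : Set (EuclideanSpace ℝ (Fin 3))) := by
      rintro w hw hw3 (⟨q, hq, hs, he⟩ | ⟨q, hq, hs, he⟩ | ⟨q, hq, -, he⟩)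
      · exact (hpos ⟨A w, hw3, q, hq, hs, he⟩).elim
      · refine ⟨q, Finset.mem_coe.2 hq, ?_⟩
        rw [hB', show R q = q from twinRefl_of_sum_eq_zero hs, he]
      · exact ⟨q, Finset.mem_coe.2 hq, he.symm⟩
    obtain ⟨n, hn1, hmenu, hdoz⟩ := hcpDozen_eq_twin_of_fccDozen_eq A B'
      (fccDozen_eq_slots_of_three_independent A B' (toF' w₁ hw₁ (Or.inl rfl) s₁)
        (toF' w₂ hw₂ (Or.inr (Or.inl rfl)) s₂) (toF' w₃ hw₃ (Or.inr (Or.inr rfl)) s₃)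
        (slotA w₁ hw₁) (slotA w₂ hw₂) (slotA w₃ hw₃) hindA)
    refine ⟨n, hn1, hmenu, ?_⟩
    rw [← hdoz]
    calc B '' (↑hcpKissingPattern : Set (EuclideanSpace ℝ (Fin 3)))
        = B '' (R '' (↑hcpKissingPattern : Set (EuclideanSpace ℝ (Fin 3)))) := by rw [twinRefl_image_hcp]
      _ = B' '' (↑hcpKissingPattern : Set (EuclideanSpace ℝ (Fin 3))) := by rw [Set.image_image]; rfl

end Summit.Ventures.Crystal3D.Theorems

end
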